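import Summits.BirchSwinnertonDyer.BirchSwinnertonDyer.Theorems.ByReductionTypeAtTwoRankOneAtTwoOffBigImageOddLocalEngineRegularInvolution
import HarnessLib

/-!
# Route `ByReductionTypeAtTwo`, crux `RankOneAtTwoOffBigImageOddLocal` (stmt-BirchSwinnertonDyer-23716), line
# `refined_kolyvagin_tamagawa_shift_at_two` — ENGINE PORT `c₀ ↦ h₀` (regular element), §L the IMAGE TOKENS `hS`/`hC` at `2` over `K`

Lead prover `prover-cruxlead-stmt-BirchSwinnertonDyer-23716-g0` (2026-08-28), landing the crux-plan g6 ENGINE QUARRY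
`Cruxes/RankOneAtTwoOffBigImageOddLocal/RefinedKolyvaginEngineG6.lean` (planner `cruxplan-…-23716-refined-kolyvag-9ff2fe475f-g6`, v10, ≈2800 lines,
rc 0 / 0 sorry; `Cruxes/` files are not importable, so the lead COPIES the proofs into `Theorems/` — card «LEAD QUICKSTART (g6)» Q2 #3 / Q4) as
`--supports stmt-BirchSwinnertonDyer-23716` helpers, continuing `…Engine{Dictionary,Parity,Cyclotomic,CyclotomicBasis,GoursatLift,Chebotarev,RegularSupply,
RegularLift}.lean`.  The engine port = kernel-closable item #3 of the pen's order (PEN-PICK-23716 ADD-4): Kolyvagin primes whose Frobenius is a REGULAR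
element `h₀` (det `−1`, trace `0`, odd mod `2`; LOSSLESS local Kummer maps by R1/LKL) instead of complex conjugation `c₀` (which loses the top bit at
`Δ > 0`, residual 24883), with McCallum's exact local orders — the supply the line's filtered stubs `…WithOn Φ_reg Ω` consume (card #7
`regular-frobenius-kolyvagin-primes-pos-disc`).  THIS FILE: §L — the swap `swp b` / `swpAut b` (defs, reviewed), `exists_eq_smul_of_comm_reg_swp` (an endomorphism commuting with the regular involution AND the swap is a scalar: the commutant computation that the tree's `exists_eq_zsmul_baseChange_of_irr` does not provide at `p = 2`), `exists_eq_zsmul_of_supply`, `imageTokens_two`, `exists_ramifiedPrime_of_doorAdmissible / _of_heegner`, `imageTokens_two_of_doorAdmissible / _of_heegner`: the image hypotheses `hS`, `hC` of Steps B–H hold at `2` over `K` from `ρ̄_{E,2}` onto plus a ramified prime — no token beyond the stub binders.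

Statements and proofs are the quarry's VERBATIM (namespace moved to `…Theorems.OffBigImageOddLocalAtTwo.Engine`).  Nothing here proves the crux,
`BSDp W 2`, BSD or the summit; no registered stub is discharged (engine inputs only).  BSD is not proved.

Refs: [GrossLMS1991] §3 (3.1)–(3.3), §9; [McCallumLMS1991] §3 (Cor. 3.2, Prop. 3.1), §5; [SilvermanAEC2009] III.7–III.8, VII–VIII; Serre (1972) §5.3.
-/

set_option linter.dupNamespace false -- tree convention: `Summit.BirchSwinnertonDyer.BirchSwinnertonDyer.Theorems` (summit = sub-problem)
set_option autoImplicit false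

noncomputable section

namespace Summit.BirchSwinnertonDyer.BirchSwinnertonDyer.Theorems.OffBigImageOddLocalAtTwo.Engine

/-! ## §L  The IMAGE TOKENS at `2` over `K` (`hS`, `hC` of Steps B–H) from `ρ̄_{E,2}` onto + the ramified prime — so that
the engine port needs NO token beyond the stub binders: the commutant of `GL₂(ℤ/m)` via `[[1,1],[0,-1]]` and the swap `[[0,1],[1,0]]`
(the tree's `exists_eq_zsmul_baseChange_of_irr` excludes `p = 2`). -/

section SwapCommutant

variable {q : ℕ} {T : Type*} [AddCommGroup T] [Module (ZMod q) T] (b : Module.Basis (Fin 2) (ZMod q) T)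

/-- The coordinate SWAP `x•b₀ + y•b₁ ↦ y•b₀ + x•b₁` (matrix `[[0,1],[1,0]]`). [folklore] -/
def swp (X : T) : T := b.repr X 1 • b 0 + b.repr X 0 • b 1

/-- First coordinate of `swp b X`: `x₁`. [folklore] -/
theorem repr_swp_zero (X : T) : b.repr (swp b X) 0 = b.repr X 1 := by
  simp [swp]

/-- Second coordinate of `swp b X`: `x₀`. [folklore] -/
theorem repr_swp_one (X : T) : b.repr (swp b X) 1 = b.repr X 0 := by
  simp [swp]

/-- `swp b` is an involution. [folklore] -/
theorem swp_swp (X : T) : swp b (swp b X) = X := by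
  refine b.ext_elem fun i ↦ ?_
  fin_cases i
  · simp [repr_swp_zero, repr_swp_one]
  · simp [repr_swp_zero, repr_swp_one]

/-- `swp b` is additive. [folklore] -/
theorem swp_add (X Y : T) : swp b (X + Y) = swp b X + swp b Y := by
  simp only [swp, map_add, Finsupp.add_apply, add_smul]
  abel

/-- `swp` as an additive automorphism. [folklore] -/
def swpAut : AddAut T where
  toFun := swp b
  invFun := swp b
  left_inv := swp_swp b
  right_inv := swp_swp b
  map_add' := swp_add b

/-- `swpAut b` acts as `swp b`. [folklore] -/
@[simp] theorem swpAut_apply (X : T) : swpAut b X = swp b X := rfl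

/-- `swp b (b 0) = b 1`. [folklore] -/
theorem swp_basis_zero : swp b (b 0) = b 1 := by
  refine b.ext_elem fun i ↦ ?_
  fin_cases i <;> simp [repr_swp_zero, repr_swp_one]

/-- **The commutant of `{[[1,1],[0,-1]], [[0,1],[1,0]]}` in `End((ℤ/q)²)` is the scalars** (so a fortiori the commutant of
`GL₂(ℤ/q)`): an additive endomorphism commuting with `reg` and `swp` is `a • id`, `a ∈ ℤ/q`. [folklore] -/
theorem exists_eq_smul_of_comm_reg_swp (f : T →+ T) (hreg : ∀ X, f (reg b X) = reg b (f X))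
    (hswp : ∀ X, f (swp b X) = swp b (f X)) : ∃ a : ZMod q, ∀ X, f X = a • X := by
  have hc : b.repr (f (b 0)) 1 = 0 := by
    have h := congrArg (fun Z ↦ b.repr Z 0) (hreg (b 0))
    simpa [reg_basis_zero, repr_reg_zero] using h
  have h10 : b.repr (f (b 1)) 0 = 0 := by
    have h := congrArg (fun Z ↦ b.repr Z 0) (hswp (b 0))
    simp only [swp_basis_zero, repr_swp_zero] at h
    rw [h, hc]
  have h11 : b.repr (f (b 1)) 1 = b.repr (f (b 0)) 0 := by
    have h := congrArg (fun Z ↦ b.repr Z 1) (hswp (b 0))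
    simpa [swp_basis_zero, repr_swp_one] using h
  set a := b.repr (f (b 0)) 0 with ha
  refine ⟨a, fun X ↦ ?_⟩
  have hf0 : f (b 0) = a • b 0 := by
    refine b.ext_elem fun j ↦ ?_
    fin_cases j
    · simp [ha]
    · simpa using hc
  have hf1 : f (b 1) = a • b 1 := by
    refine b.ext_elem fun j ↦ ?_
    fin_cases j
    · simpa using h10
    · simpa using h11
  have hX := b.sum_repr X
  rw [Fin.sum_univ_two] at hX
  calc f X = f (b.repr X 0 • b 0 + b.repr X 1 • b 1) := by rw [hX]
    _ = b.repr X 0 • f (b 0) + b.repr X 1 • f (b 1) := by rw [map_add, ZMod.map_smul, ZMod.map_smul]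
    _ = a • (b.repr X 0 • b 0 + b.repr X 1 • b 1) := by
        rw [hf0, hf1, smul_add, smul_comm (b.repr X 0) a (b 0), smul_comm (b.repr X 1) a (b 1)]
    _ = a • X := by rw [hX]

end SwapCommutant

section ImageTokensL

open WeierstrassCurve NumberField IsDedekindDomain Field
open Literature.NumberTheory.GaloisRepresentations Literature.NumberTheory.EllipticCurves Literature.NumberTheory
open Summit.BirchSwinnertonDyer.BirchSwinnertonDyer.Theorems

universe u

variable {W : WeierstrassCurve ℚ} {K : Type u} [Field K] [NumberField K]

/-- **Scalar commutant of `E(K̄)[m]` as a `Γ_K`-module, from the regular supply** (every additive automorphism of `E(ℚ̄)[m]`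
is realised by `res Γ_K`): a `Γ_K`-equivariant additive endomorphism of `E(K̄)[m]` is multiplication by an integer.  At `m = 2`
this is the tree's missing case `p = 2` of `ShimuraKolyvaginImageInputs.exists_eq_zsmul_baseChange_of_irr` (whose eigenvector
argument needs `p` odd): here the commutant of `GL₂(ℤ/m) ∋ [[1,1],[0,-1]], [[0,1],[1,0]]` is computed directly. [folklore] -/
theorem exists_eq_zsmul_of_supply [W.IsElliptic] (m : ℕ) [NeZero m]
    (hsup : ∀ A : AddAut (geomTorsion W (m : ℤ)), ∃ ρ₀ : absoluteGaloisGroup K,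
      ∀ P : geomTorsion W (m : ℤ), absGaloisRestrict ℚ K ρ₀ • P = A P)
    (f : geomTorsion (W.baseChange K) (m : ℤ) →+ geomTorsion (W.baseChange K) (m : ℤ))
    (hf : ∀ (g : absoluteGaloisGroup K) (t : geomTorsion (W.baseChange K) (m : ℤ)), f (g • t) = g • f t) :
    ∃ k : ℤ, ∀ t, f t = k • t := by
  letI : Module (ZMod m) (geomTorsion W (m : ℤ)) := AddSubgroup.torsionBy.zmodModule
  obtain ⟨b⟩ := nonempty_basis_geomTorsion W m
  set θ := RatClosure.torsionEquiv (K := K) W (m : ℤ) with hθ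
  set f₀ : geomTorsion W (m : ℤ) →+ geomTorsion W (m : ℤ) :=
    θ.symm.toAddMonoidHom.comp (f.comp θ.toAddMonoidHom) with hf₀def
  have hf₀ : ∀ X, f₀ X = θ.symm (f (θ X)) := fun X ↦ rfl
  have hcomm : ∀ (A : AddAut (geomTorsion W (m : ℤ))) (X : geomTorsion W (m : ℤ)), f₀ (A X) = A (f₀ X) := by
    intro A X
    obtain ⟨ρ₀, hρ₀⟩ := hsup A
    rw [hf₀, hf₀, ← hρ₀, ← hρ₀, RatClosure.torsionEquiv_smul, hf]
    apply θ.injective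
    rw [AddEquiv.apply_symm_apply, RatClosure.torsionEquiv_smul, AddEquiv.apply_symm_apply]
  obtain ⟨a, ha⟩ := exists_eq_smul_of_comm_reg_swp b f₀ (fun X ↦ hcomm (regAut b) X)
    (fun X ↦ hcomm (swpAut b) X)
  refine ⟨((a.val : ℕ) : ℤ), fun t ↦ ?_⟩
  have h1 : f t = θ (f₀ (θ.symm t)) := by rw [hf₀, AddEquiv.apply_symm_apply, AddEquiv.apply_symm_apply]
  have h2 : f₀ (θ.symm t) = ((a.val : ℕ) : ℤ) • θ.symm t := by
    rw [ha, natCast_zsmul, ← Nat.cast_smul_eq_nsmul (ZMod m), ZMod.natCast_zmod_val]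
  rw [h1, h2, map_zsmul, AddEquiv.apply_symm_apply]

/-- **Both image tokens of the Kolyvagin machine at `2` over `K`** — `E(K̄)[2]` a SIMPLE `Γ_K`-module (`hS`) with SCALAR commutant
(`hC`) — from `ρ̄_{E,2}` onto over `ℚ` and a prime `q ∣ d_K`, `q ∤ 2N_E` (Gross §9 disjointness, tree
`ShimuraKolyvaginImageDisjoint.exists_absGaloisRestrict_smul_eq`; simplicity via the tree's
`hasIrreducibleModPGaloisRep_of_hasSurjectiveModNGaloisRep` + `ShimuraKolyvaginImageInputs.hasIrreducibleModPGaloisRep_baseChange`). [cite: GrossLMS1991, §9] -/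
theorem imageTokens_two (hK2 : Module.finrank ℚ K = 2) {q : ℕ} (hq : q.Prime)
    (hqd : (q : ℤ) ∣ NumberField.discr K) [W.IsElliptic] (hqN : ¬ q ∣ W.conductorNorm ℤ) (hq2 : ¬ (q : ℤ) ∣ 2)
    (hρ2 : W.HasSurjectiveModNGaloisRep 2) :
    (∀ H : AddSubgroup (geomTorsion (W.baseChange K) 2),
      (∀ g : absoluteGaloisGroup K, ∀ t ∈ H, g • t ∈ H) → H = ⊥ ∨ H = ⊤) ∧
    (∀ f : geomTorsion (W.baseChange K) 2 →+ geomTorsion (W.baseChange K) 2,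
      (∀ (g : absoluteGaloisGroup K) (t : geomTorsion (W.baseChange K) 2), f (g • t) = g • f t) →
        ∃ c : ℤ, ∀ t, f t = c • t) := by
  haveI : Fact (Nat.Prime 2) := ⟨Nat.prime_two⟩
  have hirr : W.HasIrreducibleModPGaloisRep 2 :=
    hasIrreducibleModPGaloisRep_of_hasSurjectiveModNGaloisRep W 2 (by exact_mod_cast hρ2)
  refine ⟨?_, ?_⟩
  · exact ShimuraKolyvaginImageInputs.hasIrreducibleModPGaloisRep_baseChange W K hK2 hq hqd hqN
      (p := 2) (by exact_mod_cast hq2) hirr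
  · intro f hf
    refine exists_eq_zsmul_of_supply (W := W) (K := K) 2 (fun A ↦ ?_) f hf
    have hρ2' : W.HasSurjectiveModNGaloisRep ((2 : ℕ) : ℤ) := by exact_mod_cast hρ2
    obtain ⟨γ₁, hγ₁⟩ := hρ2' (Multiplicative.ofAdd A)
    obtain ⟨g, hg⟩ := ShimuraKolyvaginImageDisjoint.exists_absGaloisRestrict_smul_eq W K hK2 hq hqd hqN
      (n := ((2 : ℕ) : ℤ)) (by exact_mod_cast hq2) γ₁
    refine ⟨g, fun P ↦ ?_⟩
    rw [hg, ← galoisRepTorsion_apply, hγ₁]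
    rfl

/-- The ramified prime for the DOOR-LAW stubs: `q ∣ d_K` prime with `q ∤ N_E` (good reduction at the primes of `d_K`) and `q ≠ 2`
(`d_K ≡ 1 (8)`). [folklore] -/
theorem exists_ramifiedPrime_of_doorAdmissible [W.IsElliptic] [W.IsGloballyMinimal]
    (hK : IsImaginaryQuadratic K) (hD : RankOneAtTwoOneDoor.DoorAdmissible W (NumberField.discr K)) :
    ∃ q : ℕ, q.Prime ∧ (q : ℤ) ∣ NumberField.discr K ∧ ¬ q ∣ W.conductorNorm ℤ ∧ q ≠ 2 := by
  have hK2 : Module.finrank ℚ K = 2 := hK.1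
  obtain ⟨q, hq, hqd⟩ := ShimuraKolyvaginImageDisjoint.exists_prime_dvd_discr K (by omega)
  obtain ⟨-, -, h8, hgoodAll, -⟩ := hD
  haveI : Fact q.Prime := ⟨hq⟩
  have hgood : W.HasGoodReductionAtPrime q := hgoodAll q hq hqd ⟨hq⟩
  have hqN : ¬ q ∣ W.conductorNorm ℤ := fun h ↦
    (W.dvd_conductorNorm_iff_not_hasGoodReductionAtPrime q).mp h hgood
  have hq2 : q ≠ 2 := by
    rintro rfl
    have h2 : (2 : ℤ) ∣ NumberField.discr K := by exact_mod_cast hqd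
    omega
  exact ⟨q, hq, hqd, hqN, hq2⟩

/-- The ramified prime for the BIG-IMAGE stubs: `q ∣ d_K` prime with `q ∤ N_E` (the primes of `N_E` split: Heegner) and `q ≠ 2` (`d_K` odd).
[folklore] -/
theorem exists_ramifiedPrime_of_heegner [W.IsElliptic]
    (hK : IsImaginaryQuadratic K) (hodd : Odd (NumberField.discr K))
    (hH : SatisfiesHeegnerHypothesis (W.conductorNorm ℤ) K) :
    ∃ q : ℕ, q.Prime ∧ (q : ℤ) ∣ NumberField.discr K ∧ ¬ q ∣ W.conductorNorm ℤ ∧ q ≠ 2 := by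
  have hK2 : Module.finrank ℚ K = 2 := hK.1
  obtain ⟨q, hq, hqd, hqN⟩ := ShimuraKolyvaginImageInputs.exists_prime_dvd_discr_not_dvd K hK2
    (N := W.conductorNorm ℤ) ∅ (by simp) (fun ℓ hℓ hℓN _ ↦ hH ℓ hℓ hℓN)
  have hq2 : q ≠ 2 := by
    rintro rfl
    have h2 : (2 : ℤ) ∣ NumberField.discr K := by exact_mod_cast hqd
    exact (Int.not_even_iff_odd.mpr hodd) (even_iff_two_dvd.mpr h2)
  exact ⟨q, hq, hqd, hqN, hq2⟩

/-- An odd prime does not divide `2` in `ℤ`. [folklore] -/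
theorem not_intCast_dvd_two_of_ne_two {q : ℕ} (hq : q.Prime) (hq2 : q ≠ 2) : ¬ (q : ℤ) ∣ 2 := by
  intro h
  have h' : q ∣ 2 := by exact_mod_cast h
  exact hq2 ((Nat.prime_dvd_prime_iff_eq hq Nat.prime_two).mp h')

/-- **`hS ∧ hC` at `2` over `K` for the DOOR-LAW stubs** (binders `IsImaginaryQuadratic K`, `DoorAdmissible W d_K`, `ρ̄_{E,2}` onto). [cite: GrossLMS1991, §9] -/
theorem imageTokens_two_of_doorAdmissible [W.IsElliptic] [W.IsGloballyMinimal]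
    (hK : IsImaginaryQuadratic K) (hD : RankOneAtTwoOneDoor.DoorAdmissible W (NumberField.discr K))
    (hρ2 : W.HasSurjectiveModNGaloisRep 2) :
    (∀ H : AddSubgroup (geomTorsion (W.baseChange K) 2),
      (∀ g : absoluteGaloisGroup K, ∀ t ∈ H, g • t ∈ H) → H = ⊥ ∨ H = ⊤) ∧
    (∀ f : geomTorsion (W.baseChange K) 2 →+ geomTorsion (W.baseChange K) 2,
      (∀ (g : absoluteGaloisGroup K) (t : geomTorsion (W.baseChange K) 2), f (g • t) = g • f t) →
        ∃ c : ℤ, ∀ t, f t = c • t) := by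
  obtain ⟨q, hq, hqd, hqN, hq2⟩ := exists_ramifiedPrime_of_doorAdmissible (W := W) hK hD
  exact imageTokens_two hK.1 hq hqd hqN (not_intCast_dvd_two_of_ne_two hq hq2) hρ2

/-- **`hS ∧ hC` at `2` over `K` for the BIG-IMAGE stubs** (binders `IsImaginaryQuadratic K`, `Odd d_K`, `SatisfiesHeegnerHypothesis N_E K`,
`ρ̄_{E,2}` onto). [cite: GrossLMS1991, §9] -/
theorem imageTokens_two_of_heegner [W.IsElliptic]
    (hK : IsImaginaryQuadratic K) (hodd : Odd (NumberField.discr K))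
    (hH : SatisfiesHeegnerHypothesis (W.conductorNorm ℤ) K) (hρ2 : W.HasSurjectiveModNGaloisRep 2) :
    (∀ H : AddSubgroup (geomTorsion (W.baseChange K) 2),
      (∀ g : absoluteGaloisGroup K, ∀ t ∈ H, g • t ∈ H) → H = ⊥ ∨ H = ⊤) ∧
    (∀ f : geomTorsion (W.baseChange K) 2 →+ geomTorsion (W.baseChange K) 2,
      (∀ (g : absoluteGaloisGroup K) (t : geomTorsion (W.baseChange K) 2), f (g • t) = g • f t) →
        ∃ c : ℤ, ∀ t, f t = c • t) := by
  obtain ⟨q, hq, hqd, hqN, hq2⟩ := exists_ramifiedPrime_of_heegner (W := W) hK hodd hH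
  exact imageTokens_two hK.1 hq hqd hqN (not_intCast_dvd_two_of_ne_two hq hq2) hρ2

end ImageTokensL

end Summit.BirchSwinnertonDyer.BirchSwinnertonDyer.Theorems.OffBigImageOddLocalAtTwo.Engine

end
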